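import Summits.CriticalPhenomena.PercolationContinuityZ3.Theorems.PercNearOneGluingNoHeavyLowerTailSahiGridPattern

/-!
# `NoHeavyLowerTail` (crux stmt-CriticalPhenomena-4575), Sahi programme: **TOP-SLICE DOMINANCE implies the pattern
# inequalities in every dimension, hence Kahn's Conjecture 5**

Support file (seat `prim-ineq-gen-4`, generation 11; `--supports stmt-CriticalPhenomena-4575`).  Pure proofs, no definitions,
no `sorry`, standard axioms.

THE MATHEMATICS.  For an up-set `A ⊆ [3]^{d+1}` let `A₂ := {q ∈ [3]^d : (q,2) ∈ A}` be its TOP SLICE along the last axis (again an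
up-set).  TOP-SLICE DOMINANCE in dimension `d+1` is the inequality
  `sStarD A B C ≥ 2 · sStarD A₂ B₂ C₂`   for all up-sets `A, B, C ⊆ [3]^{d+1}`                                      (TOP_{d+1})
for the pattern functional `sStarD` of `…SahiGridPattern` (the three-copy Sahi kernel summed over the `6^{d+1}` Latin patterns).
It is a sharp graded refinement of `PatternPos`: exhaustively true for `d+1 ≤ 3` (472 037 580 (triple, axis) cells at `d+1 = 3`, the
constant `2` attained), no violation in `8·10⁷` random cells at `d+1 = 4` and `5·10⁷` at `d+1 = 5` (memo
`run/shared/lean/prim/prim-ineq-gen-4/FINDING-TOP-SLICE-DOMINANCE-g11.md`); restricted to 'upper-step' triples it is the exhaustively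
verified cube statement COMB-M⁺ (`c₂ ≥ c₃`).  This file records the (easy) reductions:
* `patternPos_of_topSlice_succ`: (TOP_{d+1}) ⟹ `PatternPos d` — apply (TOP) to the cylinders `liftSet A` (whose top slice is `A`
  and whose pattern functional is `6 · sStarD A B C`, `sStarD_liftSet`): `6 s ≥ 2 s` forces `s ≥ 0`.
* `patternPos_of_forall_topSlice`, `kahnConjecture_of_forall_topSlice`, `sahiConjecture_three_of_forall_topSlice`: (TOP) in all
  dimensions ⟹ `PatternPos d` for all `d` ⟹ Kahn's Conjecture 5 / Sahi's `C₃` (via `kahnConjecture_of_forall_patternPos`).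
HONEST LABEL.  (TOP) is a hypothesis here, never asserted; it is OPEN for `d+1 ≥ 4`. [this work]
-/

namespace Summit.CriticalPhenomena.PercolationContinuityZ3.Theorems.SahiGridPattern

open Finset
open scoped BigOperators

variable {d : ℕ}

/-- The top slice of a cylinder `liftSet A` along the last axis is `A` itself. [this work] -/
theorem filter_snoc_two_mem_liftSet (A : Finset (Pd d)) :
    (univ.filter fun q : Pd d => (Fin.snoc q 2 : Pd (d + 1)) ∈ liftSet A) = A := by
  ext q
  simp only [mem_filter, mem_univ, true_and, liftSet, Fin.init_snoc]

/-- The top slice (along the last axis) of an up-set of `[3]^{d+1}` is an up-set of `[3]^d`. [this work] -/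
theorem isUpperSet_filter_snoc_two {A : Finset (Pd (d + 1))} (hA : IsUpperSet (A : Set (Pd (d + 1)))) :
    IsUpperSet ((univ.filter fun q : Pd d => (Fin.snoc q 2 : Pd (d + 1)) ∈ A : Finset (Pd d)) : Set (Pd d)) := by
  intro q q' hqq' hq
  rw [Finset.mem_coe, mem_filter] at hq ⊢
  refine ⟨mem_univ _, hA ?_ hq.2⟩
  intro i
  refine Fin.lastCases ?_ (fun j => ?_) i
  · simp only [Fin.snoc_last, le_refl]
  · simp only [Fin.snoc_castSucc]
    exact hqq' j

/-- **Top-slice dominance one dimension up gives the pattern inequality**: if `sStarD A B C ≥ 2·sStarD A₂ B₂ C₂` for all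
up-sets of `[3]^{d+1}` (top slices along the last axis), then `PatternPos d`.  Proof: cylinders. [this work] -/
theorem patternPos_of_topSlice_succ
    (h : ∀ A B C : Finset (Pd (d + 1)), IsUpperSet (A : Set (Pd (d + 1))) → IsUpperSet (B : Set (Pd (d + 1))) →
      IsUpperSet (C : Set (Pd (d + 1))) →
      2 * sStarD (univ.filter fun q : Pd d => (Fin.snoc q 2 : Pd (d + 1)) ∈ A)
            (univ.filter fun q : Pd d => (Fin.snoc q 2 : Pd (d + 1)) ∈ B)
            (univ.filter fun q : Pd d => (Fin.snoc q 2 : Pd (d + 1)) ∈ C) ≤ sStarD A B C) :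
    PatternPos d := by
  intro A B C hA hB hC
  have h6 := h (liftSet A) (liftSet B) (liftSet C) (isUpperSet_liftSet hA) (isUpperSet_liftSet hB) (isUpperSet_liftSet hC)
  rw [filter_snoc_two_mem_liftSet, filter_snoc_two_mem_liftSet, filter_snoc_two_mem_liftSet, sStarD_liftSet] at h6
  omega

/-- **Top-slice dominance in every dimension gives the pattern inequalities in every dimension** (equivalently, by induction on
`d`: `sStarD A B C ≥ 2 sStarD A₂B₂C₂ ≥ 4 sStarD A₂₂B₂₂C₂₂ ≥ … ≥ 2^d · 0`). [this work] -/
theorem patternPos_of_forall_topSlice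
    (h : ∀ (d : ℕ) (A B C : Finset (Pd (d + 1))), IsUpperSet (A : Set (Pd (d + 1))) → IsUpperSet (B : Set (Pd (d + 1))) →
      IsUpperSet (C : Set (Pd (d + 1))) →
      2 * sStarD (univ.filter fun q : Pd d => (Fin.snoc q 2 : Pd (d + 1)) ∈ A)
            (univ.filter fun q : Pd d => (Fin.snoc q 2 : Pd (d + 1)) ∈ B)
            (univ.filter fun q : Pd d => (Fin.snoc q 2 : Pd (d + 1)) ∈ C) ≤ sStarD A B C)
    (d : ℕ) : PatternPos d :=
  patternPos_of_topSlice_succ (h d)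

/-- **Top-slice dominance in every dimension implies Sahi's conjecture `C₃`** (Sahi 2008 Conj. 5 at `n = 3`). [this work] -/
theorem sahiConjecture_three_of_forall_topSlice
    (h : ∀ (d : ℕ) (A B C : Finset (Pd (d + 1))), IsUpperSet (A : Set (Pd (d + 1))) → IsUpperSet (B : Set (Pd (d + 1))) →
      IsUpperSet (C : Set (Pd (d + 1))) →
      2 * sStarD (univ.filter fun q : Pd d => (Fin.snoc q 2 : Pd (d + 1)) ∈ A)
            (univ.filter fun q : Pd d => (Fin.snoc q 2 : Pd (d + 1)) ∈ B)
            (univ.filter fun q : Pd d => (Fin.snoc q 2 : Pd (d + 1)) ∈ C) ≤ sStarD A B C) :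
    SahiConjecture 3 :=
  sahiConjecture_three_of_forall_patternPos (patternPos_of_forall_topSlice h)

/-- **Top-slice dominance in every dimension implies Kahn's Conjecture 5** (`E₃ ≥ 0` for three increasing events under every
product measure on a finite cube). [this work] -/
theorem kahnConjecture_of_forall_topSlice
    (h : ∀ (d : ℕ) (A B C : Finset (Pd (d + 1))), IsUpperSet (A : Set (Pd (d + 1))) → IsUpperSet (B : Set (Pd (d + 1))) →
      IsUpperSet (C : Set (Pd (d + 1))) →
      2 * sStarD (univ.filter fun q : Pd d => (Fin.snoc q 2 : Pd (d + 1)) ∈ A)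
            (univ.filter fun q : Pd d => (Fin.snoc q 2 : Pd (d + 1)) ∈ B)
            (univ.filter fun q : Pd d => (Fin.snoc q 2 : Pd (d + 1)) ∈ C) ≤ sStarD A B C) :
    KahnConjecture :=
  kahnConjecture_of_forall_patternPos (patternPos_of_forall_topSlice h)

/-- The weaker hypothesis actually used: (TOP_{d+1}) for the three cylinders over `A, B, C` already gives `0 ≤ sStarD A B C`;
in particular top-slice dominance in dimension `d+1` is at least as strong as `PatternPos d` (it is `PatternPos d` with a
factor `4 = 6 − 2` to spare on cylinders). [this work] -/
theorem sStarD_nonneg_of_topSlice_liftSet (A B C : Finset (Pd d))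
    (h : 2 * sStarD (univ.filter fun q : Pd d => (Fin.snoc q 2 : Pd (d + 1)) ∈ liftSet A)
               (univ.filter fun q : Pd d => (Fin.snoc q 2 : Pd (d + 1)) ∈ liftSet B)
               (univ.filter fun q : Pd d => (Fin.snoc q 2 : Pd (d + 1)) ∈ liftSet C)
           ≤ sStarD (liftSet A) (liftSet B) (liftSet C)) :
    0 ≤ sStarD A B C := by
  rw [filter_snoc_two_mem_liftSet, filter_snoc_two_mem_liftSet, filter_snoc_two_mem_liftSet, sStarD_liftSet] at h
  omega


/-! ### Weak top-slice dominance: any factor below `6` suffices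

ADDED (same generation, after the census verdict): the factor-`2` inequality (TOP) is exhaustively true for `d+1 ≤ 3` but FALSE at
`d+1 = 5` (ttrl exhaustive cube census `m = 5`: the lower-step instance `U₁ = ↑{x₁x₃, x₂x₄, x₃x₄}, U₂ = ↑{x₀x₂x₃, x₂x₄}, U₃ = ↑{x₁x₃, x₀x₁x₄}`
of `{0,1}^5`, axis `0`, profile `(1,1,2,2)`, pulled back to `[3]^5`: `sStarD = 128 < 2·80`; reproduced with this seat's engine).  The
reduction below only needs SOME factor `c < 6` (the cylinder value), e.g. `c = 1` ("`sStarD A B C ≥ sStarD A₂ B₂ C₂`", consistent with all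
data to date: min ratio `2` for `d ≤ 3`, `≥ 3/2` on the exhaustive cube family at `m = 5`). -/

/-- **Weak top-slice dominance one dimension up gives the pattern inequality**: if for some integer `c < 6`,
`c · sStarD A₂ B₂ C₂ ≤ sStarD A B C` for all up-sets of `[3]^{d+1}`, then `PatternPos d` (cylinders: `(6 − c)·s ≥ 0`). [this work] -/
theorem patternPos_of_weakTopSlice_succ {c : ℤ} (hc : c < 6)
    (h : ∀ A B C : Finset (Pd (d + 1)), IsUpperSet (A : Set (Pd (d + 1))) → IsUpperSet (B : Set (Pd (d + 1))) →
      IsUpperSet (C : Set (Pd (d + 1))) →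
      c * sStarD (univ.filter fun q : Pd d => (Fin.snoc q 2 : Pd (d + 1)) ∈ A)
            (univ.filter fun q : Pd d => (Fin.snoc q 2 : Pd (d + 1)) ∈ B)
            (univ.filter fun q : Pd d => (Fin.snoc q 2 : Pd (d + 1)) ∈ C) ≤ sStarD A B C) :
    PatternPos d := by
  intro A B C hA hB hC
  have h6 := h (liftSet A) (liftSet B) (liftSet C) (isUpperSet_liftSet hA) (isUpperSet_liftSet hB) (isUpperSet_liftSet hC)
  rw [filter_snoc_two_mem_liftSet, filter_snoc_two_mem_liftSet, filter_snoc_two_mem_liftSet, sStarD_liftSet] at h6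
  nlinarith

/-- **Weak top-slice dominance in every dimension (any factors `c_d < 6`) gives the pattern inequalities in every dimension.** [this work] -/
theorem patternPos_of_forall_weakTopSlice (c : ℕ → ℤ) (hc : ∀ d, c d < 6)
    (h : ∀ (d : ℕ) (A B C : Finset (Pd (d + 1))), IsUpperSet (A : Set (Pd (d + 1))) → IsUpperSet (B : Set (Pd (d + 1))) →
      IsUpperSet (C : Set (Pd (d + 1))) →
      c d * sStarD (univ.filter fun q : Pd d => (Fin.snoc q 2 : Pd (d + 1)) ∈ A)
            (univ.filter fun q : Pd d => (Fin.snoc q 2 : Pd (d + 1)) ∈ B)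
            (univ.filter fun q : Pd d => (Fin.snoc q 2 : Pd (d + 1)) ∈ C) ≤ sStarD A B C)
    (d : ℕ) : PatternPos d :=
  patternPos_of_weakTopSlice_succ (hc d) (h d)

/-- **Weak top-slice dominance in every dimension implies Kahn's Conjecture 5.**  In particular the factor-`1` form
`sStarD A B C ≥ sStarD A₂ B₂ C₂` (all up-sets, all dimensions) suffices. [this work] -/
theorem kahnConjecture_of_forall_weakTopSlice (c : ℕ → ℤ) (hc : ∀ d, c d < 6)
    (h : ∀ (d : ℕ) (A B C : Finset (Pd (d + 1))), IsUpperSet (A : Set (Pd (d + 1))) → IsUpperSet (B : Set (Pd (d + 1))) →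
      IsUpperSet (C : Set (Pd (d + 1))) →
      c d * sStarD (univ.filter fun q : Pd d => (Fin.snoc q 2 : Pd (d + 1)) ∈ A)
            (univ.filter fun q : Pd d => (Fin.snoc q 2 : Pd (d + 1)) ∈ B)
            (univ.filter fun q : Pd d => (Fin.snoc q 2 : Pd (d + 1)) ∈ C) ≤ sStarD A B C) :
    KahnConjecture :=
  kahnConjecture_of_forall_patternPos (patternPos_of_forall_weakTopSlice c hc h)

end Summit.CriticalPhenomena.PercolationContinuityZ3.Theorems.SahiGridPattern
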